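import Summits.Ventures.HSemireg.WedgeHankelRecurrenceGaussSecondKind

/-!
# Venture HSemireg — **WENDROFF'S THEOREM (one step)**: ANY two strictly interlacing real point sets `x_0 < w_0 < x_1 < ⋯ < w_n < x_{n+1}` are the zeros of two consecutive polynomials of
# a positive three-term recurrence: `∏(X − x_i) = (X − a) ∏(X − w_k) − b ∏(X − v_k)` with `b > 0` and `v_0 < ⋯ < v_{n−1}` interlacing the `w_k` in turn — so the step can be iterated
# down to degree `0` (the converse of the interlacing theorem N279)

HONEST FRAMING. Part of the Lean index of the computation cell `pub-hsemireg` (seat p10 gen 42, Sunday typer «UNIFORM-IN-n»).  Real polynomials and the intermediate value theorem (N239)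
only; no variety, no cohomology theory, no sheaf, no Ext group and no semiregularity map is constructed here; nothing here says that HC / HC_CM / HC_AV holds; no Literature fact (unproved
`Prop`) is declared or used.  Custodian versions as in `WedgeHankelSiegelIdeal` (1/3).
SOURCES (cited).  B. Wendroff, *On orthogonal polynomials*, Proc. Amer. Math. Soc. 12 (1961) 554–555; T. S. Chihara, *An Introduction to Orthogonal Polynomials* (1978), Ch. I Ex. 5.10 ∕
Thm 5.3 converse («given interlacing zeros there is an OPS containing both polynomials»); G. Szegő, *Orthogonal Polynomials*, §3.3.
PROOF TYPED HERE.  `Q = ∏(X − x_i)`, `P = ∏(X − w_k)`; kill the two top coefficients: `Q = (X − a) P + r₁`, `deg r₁ ≤ n`.  At the `w_k`, `r₁(w_k) = Q(w_k)` alternates strictly (exactly one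
`x_i` between consecutive `w`'s) and `Q(w_n) < 0`; so `−r₁` has a root in every gap of `w` and, having `n` roots and degree `≤ n`, equals `b ∏(X − v_k)` with `b > 0` read off at `w_n`.
DEDUP DISCLOSURE (`rg -n 'wendroff|Wendroff' Summits Literature`, 2026-09-02): nothing.  The 5 names below: 0 hits tree-wide.

WHAT IS IN THE TREE.  N239 `exists_root_Ioo_of_mul_eval_neg`; N269 `natDegree_sub_C_mul_le_of_monic`; Mathlib `Multiset.prod_X_sub_C_dvd_iff_le_roots`,
`Polynomial.eq_leadingCoeff_mul_of_monic_of_dvd_of_natDegree_le`.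
THIS FILE (namespace `Summit.Ventures.HSemireg.Wedge.HankelOuter` continued; CHAINED on N281 (import), N269, N239; 0 definitions):
* §1047 `prod_outer_sub_mul_neg_of_interlace` (`Q(w_k) Q(w_{k+1}) < 0`), `prod_outer_sub_last_neg` (`Q(w_n) < 0`), `eq_C_mul_prod_of_roots_of_natDegree_le` (a polynomial of degree `≤ n` with
  `n` distinct roots is `lc · ∏(X − v_k)`), **`wendroff_step`** (THE THEOREM), `wendroff_step_eval` (pointwise form).
CAVEATS.  One step; iterating it (induction on `n`) yields the full recurrence — left to a successor.  Nothing Ext-side.  New names only.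
-/

open Module Polynomial
open scoped Matrix Polynomial

namespace Summit.Ventures.HSemireg.Wedge.HankelOuter

/-! ## §1047. Wendroff's theorem -/

/-- **Exactly one outer point per inner gap**: for `x_0 < w_0 < x_1 < ⋯ < w_n < x_{n+1}` and `k < n`, `∏_i (w_k − x_i) · ∏_i (w_{k+1} − x_i) < 0`. [mechanism; this file, §1047] -/
theorem prod_outer_sub_mul_neg_of_interlace {n : ℕ} {x : Fin (n + 2) → ℝ} {w : Fin (n + 1) → ℝ} (hx : StrictMono x) (hw : StrictMono w)
    (hint : ∀ k : Fin (n + 1), x k.castSucc < w k ∧ w k < x k.succ) (k : Fin n) :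
    (∏ i, (w k.castSucc - x i)) * ∏ i, (w k.succ - x i) < 0 := by
  rw [← Finset.prod_mul_distrib, ← Finset.mul_prod_erase _ _ (Finset.mem_univ k.succ.castSucc)]
  -- the middle point `x_{k+1}` lies in `(w_k, w_{k+1})`
  have hmid1 : w k.castSucc < x k.succ.castSucc := by have := (hint k.castSucc).2; rwa [show k.castSucc.succ = k.succ.castSucc from Fin.ext rfl] at this
  have hmid2 : x k.succ.castSucc < w k.succ := (hint k.succ).1
  refine mul_neg_of_neg_of_pos (mul_neg_of_neg_of_pos (sub_neg.2 hmid1) (sub_pos.2 hmid2)) (Finset.prod_pos fun i hi => ?_)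
  have hne : i ≠ k.succ.castSucc := (Finset.mem_erase.1 hi).1
  rcases lt_or_gt_of_ne hne with h | h
  · -- `i ≤ k` (as an index of `x`): `x_i ≤ x_k < w_k < w_{k+1}`
    have hle : x i ≤ x k.castSucc.castSucc := hx.monotone (by
      have : (i : ℕ) < (k : ℕ) + 1 := by simpa [Fin.lt_def] using h
      show i ≤ k.castSucc.castSucc; rw [Fin.le_def]; simp; omega)
    have h1 : x k.castSucc.castSucc < w k.castSucc := (hint k.castSucc).1
    have h2 : w k.castSucc < w k.succ := hw (Fin.castSucc_lt_succ (i := k))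
    exact mul_pos (by linarith) (by linarith)
  · -- `i ≥ k + 2`: `w_{k+1} < x_{k+2} ≤ x_i`
    have hle : x k.succ.succ ≤ x i := hx.monotone (by
      have : (k : ℕ) + 1 < (i : ℕ) := by simpa [Fin.lt_def] using h
      rw [Fin.le_def]; simp; omega)
    have h1 : w k.succ < x k.succ.succ := (hint k.succ).2
    have h2 : w k.castSucc < w k.succ := hw (Fin.castSucc_lt_succ (i := k))
    exact mul_pos_of_neg_of_neg (by linarith) (by linarith)

/-- **`Q(w_n) < 0`**: only the last outer point exceeds the last inner point. [mechanism; this file, §1047] -/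
theorem prod_outer_sub_last_neg {n : ℕ} {x : Fin (n + 2) → ℝ} {w : Fin (n + 1) → ℝ} (hw : StrictMono w)
    (hint : ∀ k : Fin (n + 1), x k.castSucc < w k ∧ w k < x k.succ) : ∏ i, (w (Fin.last n) - x i) < 0 := by
  rw [← Finset.mul_prod_erase _ _ (Finset.mem_univ (Fin.last (n + 1)))]
  have hlast : w (Fin.last n) < x (Fin.last (n + 1)) := by have := (hint (Fin.last n)).2; rwa [Fin.succ_last] at this
  refine mul_neg_of_neg_of_pos (sub_neg.2 hlast) (Finset.prod_pos fun i hi => ?_)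
  have hne : i ≠ Fin.last (n + 1) := (Finset.mem_erase.1 hi).1
  -- `i = j.castSucc`, and `x_j < w_j ≤ w_n`
  have h1 : x (i.castPred hne).castSucc < w (i.castPred hne) := (hint _).1
  rw [Fin.castSucc_castPred] at h1
  exact sub_pos.2 (lt_of_lt_of_le h1 (hw.monotone (Fin.le_last _)))

/-- A non-zero polynomial of degree `≤ n` with `n` distinct roots `v_k` is `lc · ∏(X − v_k)`. [bookkeeping; this file, §1047] -/
theorem eq_C_mul_prod_of_roots_of_natDegree_le {n : ℕ} {p : ℝ[X]} (hp : p ≠ 0) (hpd : p.natDegree ≤ n) {v : Fin n → ℝ} (hv : Function.Injective v) (hroot : ∀ k, p.eval (v k) = 0) :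
    p = C p.leadingCoeff * ∏ k, (Polynomial.X - C (v k)) := by
  classical
  have hPm : (∏ k, (Polynomial.X - C (v k))).Monic := monic_prod_of_monic _ _ fun k _ => monic_X_sub_C (v k)
  have hPd : (∏ k, (Polynomial.X - C (v k))).natDegree = n := by
    rw [natDegree_prod_of_monic _ _ fun k _ => monic_X_sub_C (v k)]
    simp only [natDegree_X_sub_C, Finset.sum_const, Finset.card_univ, Fintype.card_fin, smul_eq_mul, mul_one]
  have hdvd : (∏ k, (Polynomial.X - C (v k))) ∣ p := by
    have hroots : (Finset.univ.val.map v) ≤ p.roots := by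
      rw [Multiset.le_iff_subset (Multiset.Nodup.map hv Finset.univ.nodup)]
      intro z hz
      obtain ⟨k, -, rfl⟩ := Multiset.mem_map.1 hz
      exact (mem_roots hp).2 (hroot k)
    have h := (Multiset.prod_X_sub_C_dvd_iff_le_roots hp (Finset.univ.val.map v)).2 hroots
    rwa [Multiset.map_map, show ((fun a => Polynomial.X - C a) ∘ v) = fun k => Polynomial.X - C (v k) from rfl, Finset.prod_map_val] at h
  exact eq_leadingCoeff_mul_of_monic_of_dvd_of_natDegree_le hPm hdvd (by rw [hPd]; exact hpd)

/-- **WENDROFF'S THEOREM (one step).**  If `x_0 < w_0 < x_1 < w_1 < ⋯ < w_n < x_{n+1}`, then there are `a`, `b > 0` and `v_0 < ⋯ < v_{n−1}` with `w_k < v_k < w_{k+1}` such that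
`∏_i (X − x_i) = (X − a) ∏_k (X − w_k) − b ∏_k (X − v_k)`. [Wendroff 1961; Chihara I Ex. 5.10; this file, §1047] -/
theorem wendroff_step {n : ℕ} {x : Fin (n + 2) → ℝ} {w : Fin (n + 1) → ℝ} (hx : StrictMono x) (hw : StrictMono w)
    (hint : ∀ k : Fin (n + 1), x k.castSucc < w k ∧ w k < x k.succ) :
    ∃ (a b : ℝ) (v : Fin n → ℝ), 0 < b ∧ StrictMono v ∧ (∀ k : Fin n, w k.castSucc < v k ∧ v k < w k.succ) ∧
      ∏ i, (Polynomial.X - C (x i)) = (Polynomial.X - C a) * ∏ k, (Polynomial.X - C (w k)) - C b * ∏ k, (Polynomial.X - C (v k)) := by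
  classical
  set Q : ℝ[X] := ∏ i, (Polynomial.X - C (x i)) with hQ
  set P : ℝ[X] := ∏ k, (Polynomial.X - C (w k)) with hP
  have hQm : Q.Monic := monic_prod_of_monic _ _ fun i _ => monic_X_sub_C (x i)
  have hPm : P.Monic := monic_prod_of_monic _ _ fun k _ => monic_X_sub_C (w k)
  have hQd : Q.natDegree = n + 2 := by
    rw [hQ, natDegree_prod_of_monic _ _ fun i _ => monic_X_sub_C (x i)]
    simp only [natDegree_X_sub_C, Finset.sum_const, Finset.card_univ, Fintype.card_fin, smul_eq_mul, mul_one]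
  have hPd : P.natDegree = n + 1 := by
    rw [hP, natDegree_prod_of_monic _ _ fun k _ => monic_X_sub_C (w k)]
    simp only [natDegree_X_sub_C, Finset.sum_const, Finset.card_univ, Fintype.card_fin, smul_eq_mul, mul_one]
  -- kill the top two coefficients
  have hXPm : (Polynomial.X * P).Monic := monic_X.mul hPm
  have hXPd : (Polynomial.X * P).natDegree = n + 2 := by rw [monic_X.natDegree_mul hPm, natDegree_X, hPd]; ring
  set r : ℝ[X] := Q - Polynomial.X * P with hr
  have hrd : r.natDegree ≤ n + 1 := by
    have h := natDegree_sub_C_mul_le_of_monic hQd.le hXPm hXPd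
    have hc : Q.coeff (n + 2) = 1 := by rw [← hQd]; exact hQm.coeff_natDegree
    rw [hc, C_1, one_mul] at h
    simpa using h
  set c : ℝ := r.coeff (n + 1) with hc
  set r₁ : ℝ[X] := r - C c * P with hr₁
  have hr₁d : r₁.natDegree ≤ n := by have := natDegree_sub_C_mul_le_of_monic hrd hPm hPd; simpa using this
  have hQdecomp : Q = (Polynomial.X - C (-c)) * P + r₁ := by rw [hr₁, hr, C_neg]; ring
  -- values of `r₁` at the `w_k`
  have hPw : ∀ k, P.eval (w k) = 0 := fun k => by rw [hP, eval_prod]; exact Finset.prod_eq_zero (Finset.mem_univ k) (by simp)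
  have hr₁w : ∀ k, r₁.eval (w k) = ∏ i, (w k - x i) := fun k => by
    have h := congrArg (fun F => F.eval (w k)) hQdecomp
    simp only [eval_add, eval_mul, hPw k, mul_zero, zero_add] at h
    rw [← h, hQ, eval_prod]
    exact Finset.prod_congr rfl fun i _ => by rw [eval_sub, eval_X, eval_C]
  -- `S = −r₁` alternates on `w` and is positive at `w_n`
  set S : ℝ[X] := -r₁ with hS
  have hSw : ∀ k, S.eval (w k) = -∏ i, (w k - x i) := fun k => by rw [hS, eval_neg, hr₁w]
  have hSalt : ∀ k : Fin n, S.eval (w k.castSucc) * S.eval (w k.succ) < 0 := fun k => by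
    rw [hSw, hSw, neg_mul_neg]; exact prod_outer_sub_mul_neg_of_interlace hx hw hint k
  have hSlast : 0 < S.eval (w (Fin.last n)) := by rw [hSw]; exact neg_pos.2 (prod_outer_sub_last_neg hw hint)
  have hSne : S ≠ 0 := fun h0 => by rw [h0, eval_zero] at hSlast; exact lt_irrefl _ hSlast
  have hSd : S.natDegree ≤ n := by rw [hS, natDegree_neg]; exact hr₁d
  -- a root of `S` in each gap of `w`
  have hgap : ∀ k : Fin n, ∃ z, w k.castSucc < z ∧ z < w k.succ ∧ S.IsRoot z := fun k =>
    exists_root_Ioo_of_mul_eval_neg (hw (Fin.castSucc_lt_succ (i := k))) (hSalt k)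
  choose v hv1 hv2 hv3 using hgap
  have hvmono : StrictMono v := fun i j hij => by
    have h1 : v i < w i.succ := hv2 i
    have h2 : w j.castSucc < v j := hv1 j
    have h3 : w i.succ ≤ w j.castSucc := hw.monotone (Fin.succ_le_castSucc_iff.2 hij)
    linarith
  -- `S = b ∏(X − v_k)` with `b = lc S > 0`
  have hfac := eq_C_mul_prod_of_roots_of_natDegree_le hSne hSd hvmono.injective (fun k => hv3 k)
  set b : ℝ := S.leadingCoeff with hb
  have hbpos : 0 < b := by
    have h := hSlast
    rw [hfac, eval_mul, eval_C, eval_prod] at h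
    have hpos : 0 < ∏ k, (Polynomial.X - C (v k)).eval (w (Fin.last n)) := Finset.prod_pos fun k _ => by
      rw [eval_sub, eval_X, eval_C]
      exact sub_pos.2 (lt_of_lt_of_le (hv2 k) (hw.monotone (Fin.le_last _)))
    exact (pos_iff_pos_of_mul_pos h).2 hpos
  refine ⟨-c, b, v, hbpos, hvmono, fun k => ⟨hv1 k, hv2 k⟩, ?_⟩
  rw [hQdecomp, show r₁ = -S by rw [hS, neg_neg], hfac]
  ring

/-- **Wendroff's step, pointwise**: `∏_i (y − x_i) = (y − a) ∏_k (y − w_k) − b ∏_k (y − v_k)` for all real `y`. [Wendroff 1961; this file, §1047] -/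
theorem wendroff_step_eval {n : ℕ} {x : Fin (n + 2) → ℝ} {w : Fin (n + 1) → ℝ} (hx : StrictMono x) (hw : StrictMono w)
    (hint : ∀ k : Fin (n + 1), x k.castSucc < w k ∧ w k < x k.succ) :
    ∃ (a b : ℝ) (v : Fin n → ℝ), 0 < b ∧ StrictMono v ∧ (∀ k : Fin n, w k.castSucc < v k ∧ v k < w k.succ) ∧
      ∀ y : ℝ, ∏ i, (y - x i) = (y - a) * ∏ k, (y - w k) - b * ∏ k, (y - v k) := by
  obtain ⟨a, b, v, hb, hv, hvw, h⟩ := wendroff_step hx hw hint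
  refine ⟨a, b, v, hb, hv, hvw, fun y => ?_⟩
  have := congrArg (fun F => F.eval y) h
  simp only [eval_prod, eval_sub, eval_mul, eval_X, eval_C] at this
  exact this

end Summit.Ventures.HSemireg.Wedge.HankelOuter
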